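import Summits.AtomisticToContinuum.FouriersLaw.Theorems.BondHeatUncertaintyLinearResponseFTURLineDefs
import Summits.AtomisticToContinuum.FouriersLaw.Theorems.JunctionLocalityDefs
import Literature.MathematicalPhysics.KineticTheory.LangevinChainKernel
import Literature.MathematicalPhysics.KineticTheory.LangevinChainGibbs

/-!
# Line `drude-controls-conductance` (reshape R1) of crux `NonBallistic` (stmt-AtomisticToContinuum-9127):
# posited objects and stub statements

Definitions-and-statements file of the line lead (prover-line-stmt-AtomisticToContinuum-9127-c2-0) for the crux
`JunctionLocality.NonBallistic` (shared verbatim by `PuiseuxTransferLedger.NonBallistic`, `BondHeatUncertainty.NonBallistic`),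
line `drude-controls-conductance` in its reshape R1 = the triage-r1 merge with the twin line `transit-entropy-pairing`:
the LEVER is the Hasegawa–Van Vu fluctuation-theorem uncertainty relation for the time-integrated TOTAL current
`Φ_t = ∫₀ᵗ J_tot(z_s) ds` of the two-temperature steady process (`TotalCurrentFTUR`, the planner's `stub_totalCurrentFTUR`
verbatim), the CUT is the twin's single windowed equilibrium statement (`SubballisticTransitWindow`, the planner's
`stub_subballisticTransitWindow` verbatim), and the extensive snapshot irreversibility (K) is the route item
`BondHeatUncertainty.ExtensiveSnapshotIrreversibility` (stmt-AtomisticToContinuum-9121) consumed by name in the skeleton.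

This file fixes, once, the vocabulary in which the fixed-`N` stubs of the lever are registered and landed, exactly as
`Theorems/BondHeatUncertaintyLinearResponseFTURLineDefs.lean` did for the bond-heat twin (★) `LinearResponseFTUR`
(stmt-AtomisticToContinuum-9122, CLOSED), whose landed machinery (observable space `Obs N`, `fluxLaw`, entropy balance,
steady heat rates, flow laws) the lever reuses with ONE new observable:

* `leftEnergyMoment P N x = Σ_{b=0}^{N-2} E_{≤b}(x)`, the sum over the real bonds of the LEFT block energies
  `E_{≤b} = Σ_{i≤b}(p_i²/2 + U(q_i)) + Σ_{bonds inside} V + ½V(q_{b+1}-q_b)` (closed form: site `i` weighs `N-1-i`,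
  bond `(i,i+1)` weighs `N-i-3/2`);
* `totalHeatObs P N i0 : Obs N → ℝ`, `(x_0, x_t, I_L, I_R, Q^b) ↦ (N-1)·Q_L - (M(x_t) - M(x_0))` with `Q_L = leftHeat`,
  `M = leftEnergyMoment` — by the block energy balances `∫₀ᵗ j_b = Q_L - ΔE_{≤b}` (every real bond `b ≤ N-2`; only the
  LEFT bath touches a left block) this IS `Φ_t` along every forward path (`TotalHeatPathwiseIdentity`), and it is ODD under
  the time-reversal-and-flip involution `flipObs` (`totalHeatObs_flipObs`), so the vendored FTUR applies to it on the
  endpoint–heat marginal where the entropy balance of (★) lives;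
* `timeIntegratedCurrent P N T_L T_R t (z, w) = ∫₀ᵗ J_tot(Φ_s(z, B(w))) ds`, the path functional itself
  (`J_tot = totalCurrentObs`, `Φ = OscillatorChain.solMap`, `B = pairPath`).

Then the statements (all `let`-free; the equilibrium total-current autocorrelation `C_N(s) = ∫ J_tot·(κ_s J_tot) dπ_T`
enters through a function variable `C` pinned by ONE defining equation, the planners' convention, so that the two verbatim
planner stubs keep their registered texts): `AutocorrelationContinuous` (planner stub 1, shared by both twins),
`TotalCurrentFTUR` (planner stub 2 of `drude-controls-conductance`), `SubballisticTransitWindow` (planner stub 4 of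
`transit-entropy-pairing`), and the lead's split of the lever along the tree's flow-law lemmas —
`TimeIntegratedCurrentMean`, `EquilibriumTimeIntegratedCurrentVariance`, `TimeIntegratedCurrentVarianceContinuity`,
`TotalHeatPathwiseIdentity` — whose conjunction gives `TotalCurrentFTUR` by the (★) transfer pattern
(`LinearResponseFTUR.Line.transfer`). Everything is an explicit abbreviation of tree objects; nothing carries axioms; no
statement of the route is restated (the crux is concluded only in the skeleton `Cruxes/NonBallistic/Lines/…`).
-/

noncomputable section

namespace Summit.AtomisticToContinuum.FouriersLaw.Theorems.NonBallistic.DrudeLine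

open MeasureTheory ProbabilityTheory Filter Topology
open scoped NNReal ENNReal BigOperators
open Literature.MathematicalPhysics.KineticTheory
open Literature.MathematicalPhysics.KineticTheory.HeatConduction
open Literature.Probability.Process
open Summit.AtomisticToContinuum.FouriersLaw.Theorems.BondHeatUncertainty
open Summit.AtomisticToContinuum.FouriersLaw.Theorems.JunctionLocality

/-! ## Posited objects -/

/-- The **left energy moment** `M(x) = Σ_{b=0}^{N-2} E_{≤b}(x)`, the sum over the real bonds `(b, b+1)` of the
energies of the left blocks `E_{≤b}(x) = Σ_{i ≤ b} (p_i²/2 + U(q_i)) + Σ_{i+1 ≤ b} V(q_{i+1} - q_i) + ½ V(q_{b+1} - q_b)`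
(half of the cut bond, the convention under which `d/dt E_{≤b} = -j_b +` left-bath heat rate, `j_b` the tree's symmetric
bond current), in closed form: site `i` is counted `N - 1 - i` times, bond `(i, i+1)` with weight `N - i - 3/2`. -/
def leftEnergyMoment (P : OscillatorChain) (N : ℕ) (x : PhaseSpace N) : ℝ :=
  ∑ i : Fin N, (((N : ℝ) - 1 - (i : ℕ)) * (x.2 i ^ 2 / 2 + P.U (x.1 i)) +
    ∑ j : Fin N, if j.val = i.val + 1 then ((N : ℝ) - (i : ℕ) - 3 / 2) * P.V (x.1 j - x.1 i) else 0)

/-- The **total-heat observable** on the endpoint–heat space `Obs N = (x_0, x_t, I_L, I_R, Q^b)`: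
`(N - 1) · Q_L - (M(x_t) - M(x_0))`, `Q_L = leftHeat i0` the heat absorbed from the left bath, `M = leftEnergyMoment`.
Along every forward path it equals the time-integrated total current `Φ_t = Σ_b ∫₀ᵗ j_b` (block energy balances,
`TotalHeatPathwiseIdentity`); it ignores the coordinates `I_R` and `Q^b`. -/
def totalHeatObs (P : OscillatorChain) (N : ℕ) (i0 : Fin N) (p : Obs N) : ℝ :=
  ((N : ℝ) - 1) * leftHeat i0 p - (leftEnergyMoment P N p.2.1 - leftEnergyMoment P N p.1)

/-- The **time-integrated total current** `Φ_t(z, w) = ∫₀ᵗ J_tot(Φ_s(z, B(w))) ds` of the forward (damped) path from `z`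
driven by the Brownian pair of the raw sample `w` (`J_tot = totalCurrentObs`, `Φ_s = OscillatorChain.solMap`). -/
def timeIntegratedCurrent (P : OscillatorChain) (N : ℕ) (T_L T_R t : ℝ) (zw : PhaseSpace N × WienerPair) : ℝ :=
  ∫ s in (0 : ℝ)..t, totalCurrentObs P N (P.solMap N T_L T_R s zw.1 (pairPath zw.2))

/-! ### Elementary facts about the vocabulary -/

/-- Unfolding `leftEnergyMoment`. -/
theorem leftEnergyMoment_def (P : OscillatorChain) (N : ℕ) (x : PhaseSpace N) :
    leftEnergyMoment P N x = ∑ i : Fin N, (((N : ℝ) - 1 - (i : ℕ)) * (x.2 i ^ 2 / 2 + P.U (x.1 i)) +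
      ∑ j : Fin N, if j.val = i.val + 1 then ((N : ℝ) - (i : ℕ) - 3 / 2) * P.V (x.1 j - x.1 i) else 0) := rfl

/-- Unfolding `totalHeatObs`. -/
theorem totalHeatObs_def (P : OscillatorChain) (N : ℕ) (i0 : Fin N) (p : Obs N) :
    totalHeatObs P N i0 p = ((N : ℝ) - 1) * leftHeat i0 p - (leftEnergyMoment P N p.2.1 - leftEnergyMoment P N p.1) :=
  rfl

/-- Unfolding `timeIntegratedCurrent`. -/
theorem timeIntegratedCurrent_def (P : OscillatorChain) (N : ℕ) (T_L T_R t : ℝ) (zw : PhaseSpace N × WienerPair) :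
    timeIntegratedCurrent P N T_L T_R t zw =
      ∫ s in (0 : ℝ)..t, totalCurrentObs P N (P.solMap N T_L T_R s zw.1 (pairPath zw.2)) := rfl

/-- The left energy moment is EVEN under momentum reversal `Θ (q, p) = (q, -p)`. -/
theorem leftEnergyMoment_neg_momentum (P : OscillatorChain) (N : ℕ) (x : PhaseSpace N) :
    leftEnergyMoment P N (x.1, -x.2) = leftEnergyMoment P N x := by
  simp only [leftEnergyMoment, Pi.neg_apply, neg_sq]

/-- The total-heat observable is ODD under the time-reversal-and-flip involution `Θ̃ = flipObs`
(`(x, y, u, v, e) ↦ (Θy, Θx, -u, -v, -e)`): the left heat flips sign (`leftHeat_flipObs`) and the endpoint energies swap. -/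
theorem totalHeatObs_flipObs :
    ∀ (P : OscillatorChain) (N : ℕ) (i0 : Fin N) (p : Obs N),
      totalHeatObs P N i0 (flipObs N p) = -totalHeatObs P N i0 p := by
  intro P N i0 p
  have h1 : (flipObs N p).2.1 = (p.1.1, -p.1.2) := rfl
  have h2 : (flipObs N p).1 = (p.2.1.1, -p.2.1.2) := rfl
  rw [totalHeatObs, totalHeatObs, leftHeat_flipObs, h1, h2, leftEnergyMoment_neg_momentum,
    leftEnergyMoment_neg_momentum]
  ring

/-- `totalHeatObs` is measurable (a polynomial-type expression in finitely many coordinates, for continuous `U, V`). -/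
theorem measurable_totalHeatObs :
    ∀ (P : OscillatorChain), Continuous P.U → Continuous P.V → ∀ (N : ℕ) (i0 : Fin N),
      Measurable (totalHeatObs P N i0) := by
  intro P hU hV N i0
  have hM : Continuous (leftEnergyMoment P N) := by
    unfold leftEnergyMoment
    refine continuous_finsetSum _ fun i _ => ?_
    refine Continuous.add (by fun_prop) (continuous_finsetSum _ fun j _ => ?_)
    by_cases h : j.val = i.val + 1
    · simp only [h, if_true]
      fun_prop
    · simp only [h, if_false]
      exact continuous_const
  have hL : Continuous (leftHeat (N := N) i0) := by
    unfold leftHeat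
    fun_prop
  have h : Continuous (totalHeatObs P N i0) := by
    unfold totalHeatObs
    fun_prop
  exact h.measurable

/-! ## The stub statements of the line (reshape R1) -/

/-- **`AutocorrelationContinuous`** — VERBATIM the planners' `stub_autocorrelationContinuous` (stub 1 of BOTH twins
`drude-controls-conductance` and `transit-entropy-pairing`): for the pinned chain (all parameters `> 0`), `T > 0` and the
equilibrium total-current autocorrelation `C` pinned by its defining equation, `s ↦ C_N(s)` is continuous for every `N`. -/
def AutocorrelationContinuous : Prop :=
    ∀ ω₂ lam β γ : ℝ, 0 < ω₂ → 0 < lam → 0 < β → 0 < γ → ∀ T : ℝ, 0 < T →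
    ∀ C : ℕ → ℝ → ℝ,
      C = (fun (N : ℕ) (s : ℝ) => ∫ x, (∑ i : Fin N, (pinnedChain ω₂ lam β γ).bondCurrent N i x) *
            (∫ y, (∑ i : Fin N, (pinnedChain ω₂ lam β γ).bondCurrent N i y)
              ∂((pinnedChain ω₂ lam β γ).transitionKernel N T T s.toNNReal x))
            ∂((pinnedChain ω₂ lam β γ).gibbsMeasure N T)) →
      ∀ N : ℕ, Continuous (C N)

/-- **`TotalCurrentFTUR`** — VERBATIM the planner's `stub_totalCurrentFTUR` (stub 2, THE LEVER, of
`drude-controls-conductance`): under weak-NESS uniqueness, along every steady-state family, for `T > 0`, response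
coefficients `D`, `C` pinned by its defining equation, `N ≥ 2` with `C N` continuous, `t > 0`, `K ≥ 0` with
`KL(μ_{N,δ} ‖ Θ_*μ_{N,δ}) ≤ Kδ²` eventually: `2 (D_N t)² ≤ Var_eq(Φ_t) · (D_N/(N-1) · t/T² + K)`,
`Var_eq(Φ_t) = 2∫₀ᵗ(t-s)C_N(s)ds`. -/
def TotalCurrentFTUR : Prop :=
    ∀ ω₂ lam β γ : ℝ, 0 < ω₂ → 0 < lam → 0 < β → 0 < γ →
    (∀ (N : ℕ) (T_L T_R : ℝ), 0 < T_L → 0 < T_R → ∀ μ ν : Measure (PhaseSpace N),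
      (pinnedChain ω₂ lam β γ).IsSteadyState N T_L T_R μ →
      (pinnedChain ω₂ lam β γ).IsSteadyState N T_L T_R ν → μ = ν) →
    ∀ μ : (N : ℕ) → ℝ → ℝ → Measure (PhaseSpace N),
      (∀ (N : ℕ) (T_L T_R : ℝ), 0 < T_L → 0 < T_R →
        (pinnedChain ω₂ lam β γ).IsSteadyState N T_L T_R (μ N T_L T_R)) →
    ∀ T : ℝ, 0 < T → ∀ D : ℕ → ℝ,
      (∀ N : ℕ, Tendsto (fun δ : ℝ =>
        (pinnedChain ω₂ lam β γ).totalCurrent (μ N (T + δ / 2) (T - δ / 2)) / δ) (𝓝[≠] 0) (𝓝 (D N))) →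
    ∀ C : ℕ → ℝ → ℝ,
      C = (fun (N : ℕ) (s : ℝ) => ∫ x, (∑ i : Fin N, (pinnedChain ω₂ lam β γ).bondCurrent N i x) *
            (∫ y, (∑ i : Fin N, (pinnedChain ω₂ lam β γ).bondCurrent N i y)
              ∂((pinnedChain ω₂ lam β γ).transitionKernel N T T s.toNNReal x))
            ∂((pinnedChain ω₂ lam β γ).gibbsMeasure N T)) →
    ∀ N : ℕ, 2 ≤ N → Continuous (C N) →
    ∀ t : ℝ, 0 < t → ∀ K : ℝ, 0 ≤ K →
      (∀ᶠ δ in 𝓝[≠] (0 : ℝ),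
        InformationTheory.klDiv (μ N (T + δ / 2) (T - δ / 2))
            ((μ N (T + δ / 2) (T - δ / 2)).map (fun x : PhaseSpace N => (x.1, -x.2)))
          ≤ ENNReal.ofReal (K * δ ^ 2)) →
      2 * (D N) ^ 2 * t ^ 2 ≤
        (2 * ∫ s in (0 : ℝ)..t, (t - s) * C N s) * (D N / ((N : ℝ) - 1) * t / T ^ 2 + K)

/-- **`SubballisticTransitWindow`** — VERBATIM the planner's `stub_subballisticTransitWindow` (stub 4, the transferred crux
`C⁺`, of `transit-entropy-pairing`): for the pinned chain (all parameters `> 0`), `T > 0`, `C` pinned by its defining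
equation: `∃ a > 0 ∀ ε > 0 ∃ N₀ ∀ N ≥ N₀ ∃ τ ∈ (0, aN]`, `2∫₀^τ (τ-s) C_N(s) ds ≤ ε N τ²` — the equilibrium time-integrated
total current is sub-ballistic somewhere inside the transit window, uniformly in large `N` (zero Drude weight in finite-`N`
windowed form; FALSE for the harmonic member, where it equals `χ_j N τ² (1 - O(1/N))`; the only stub using `lam, β > 0`). -/
def SubballisticTransitWindow : Prop :=
    ∀ ω₂ lam β γ : ℝ, 0 < ω₂ → 0 < lam → 0 < β → 0 < γ → ∀ T : ℝ, 0 < T →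
    ∀ C : ℕ → ℝ → ℝ,
      C = (fun (N : ℕ) (s : ℝ) => ∫ x, (∑ i : Fin N, (pinnedChain ω₂ lam β γ).bondCurrent N i x) *
            (∫ y, (∑ i : Fin N, (pinnedChain ω₂ lam β γ).bondCurrent N i y)
              ∂((pinnedChain ω₂ lam β γ).transitionKernel N T T s.toNNReal x))
            ∂((pinnedChain ω₂ lam β γ).gibbsMeasure N T)) →
      ∃ a : ℝ, 0 < a ∧ ∀ ε : ℝ, 0 < ε → ∃ N₀ : ℕ, ∀ N : ℕ, N₀ ≤ N →
        ∃ τ : ℝ, 0 < τ ∧ τ ≤ a * (N : ℝ) ∧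
          (2 * ∫ s in (0 : ℝ)..τ, (τ - s) * C N s) ≤ ε * (N : ℝ) * τ ^ 2

/-- **`TimeIntegratedCurrentMean`** (lead's split of the lever, part 1; fixed `N`, size S–M): under weak-NESS uniqueness,
along a steady-state family, for `N ≥ 2`, `T_L, T_R > 0`, `t ≥ 0`, the time-integrated total current along the stationary
forward process is integrable and has mean `t · totalCurrent(μ_{N,T_L,T_R})` (the member is the kernel-invariant
Krylov–Bogoliubov state, `LinearResponseFTUR.ness_facts`; one-time law + Fubini,
`LinearResponseFTUR.EquilibriumBondHeatVariance.pinnedChain_integral_intervalIntegral_of_invariant` with `f = J_tot`;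
`totalCurrent μ = ∫ J_tot dμ`, `JunctionLocality.totalCurrent_eq_integral_totalCurrentObs`). -/
def TimeIntegratedCurrentMean : Prop :=
    ∀ ω₂ lam β γ : ℝ, 0 < ω₂ → 0 < lam → 0 < β → 0 < γ →
    (∀ (N : ℕ) (T_L T_R : ℝ), 0 < T_L → 0 < T_R → ∀ μ ν : Measure (PhaseSpace N),
      (pinnedChain ω₂ lam β γ).IsSteadyState N T_L T_R μ →
      (pinnedChain ω₂ lam β γ).IsSteadyState N T_L T_R ν → μ = ν) →
    ∀ μ : (N : ℕ) → ℝ → ℝ → Measure (PhaseSpace N),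
      (∀ (N : ℕ) (T_L T_R : ℝ), 0 < T_L → 0 < T_R →
        (pinnedChain ω₂ lam β γ).IsSteadyState N T_L T_R (μ N T_L T_R)) →
    ∀ N : ℕ, 2 ≤ N → ∀ (T_L T_R : ℝ), 0 < T_L → 0 < T_R → ∀ t : ℝ, 0 ≤ t →
      Integrable (timeIntegratedCurrent (pinnedChain ω₂ lam β γ) N T_L T_R t) ((μ N T_L T_R).prod wienerPair) ∧
      ∫ zw, timeIntegratedCurrent (pinnedChain ω₂ lam β γ) N T_L T_R t zw ∂((μ N T_L T_R).prod wienerPair) =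
        t * (pinnedChain ω₂ lam β γ).totalCurrent (μ N T_L T_R)

/-- **`EquilibriumTimeIntegratedCurrentVariance`** (part 2; fixed `N`, size M): under weak-NESS uniqueness (which makes the
Gibbs measure `π_T = gibbsMeasure N T` invariant for the constructed equal-temperature kernels,
`LinearResponseFTUR.gibbsMeasure_bind_transitionKernel`), for `T > 0`, `C` pinned by its defining equation, `N ≥ 2` and
`t ≥ 0`: `Φ_t ∈ L²(π_T ⊗ W)` and `Var(Φ_t) = 2∫₀ᵗ (t-s) C_N(s) ds` (mean `t·π_T(J_tot) = 0` by momentum parity; second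
moment by the two-time law of the stationary flow, `SubdiffusiveBondHeat.pinnedChain_integral_sq_intervalIntegral_of_invariant`
with `f = J_tot`). -/
def EquilibriumTimeIntegratedCurrentVariance : Prop :=
    ∀ ω₂ lam β γ : ℝ, 0 < ω₂ → 0 < lam → 0 < β → 0 < γ →
    (∀ (N : ℕ) (T_L T_R : ℝ), 0 < T_L → 0 < T_R → ∀ μ ν : Measure (PhaseSpace N),
      (pinnedChain ω₂ lam β γ).IsSteadyState N T_L T_R μ →
      (pinnedChain ω₂ lam β γ).IsSteadyState N T_L T_R ν → μ = ν) →
    ∀ T : ℝ, 0 < T →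
    ∀ C : ℕ → ℝ → ℝ,
      C = (fun (N : ℕ) (s : ℝ) => ∫ x, (∑ i : Fin N, (pinnedChain ω₂ lam β γ).bondCurrent N i x) *
            (∫ y, (∑ i : Fin N, (pinnedChain ω₂ lam β γ).bondCurrent N i y)
              ∂((pinnedChain ω₂ lam β γ).transitionKernel N T T s.toNNReal x))
            ∂((pinnedChain ω₂ lam β γ).gibbsMeasure N T)) →
    ∀ N : ℕ, 2 ≤ N → ∀ t : ℝ, 0 ≤ t →
      MemLp (timeIntegratedCurrent (pinnedChain ω₂ lam β γ) N T T t) 2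
          (((pinnedChain ω₂ lam β γ).gibbsMeasure N T).prod wienerPair) ∧
        variance (timeIntegratedCurrent (pinnedChain ω₂ lam β γ) N T T t)
            (((pinnedChain ω₂ lam β γ).gibbsMeasure N T).prod wienerPair) =
          2 * ∫ s in (0 : ℝ)..t, (t - s) * C N s

/-- **`TimeIntegratedCurrentVarianceContinuity`** (part 3; fixed `N`, size L — the total-current twin of the landed K6b
`LinearResponseFTUR.stub_bondHeatVarianceContinuity`): under weak-NESS uniqueness, along a steady-state family at
`T ± δ/2`, for `T > 0`, `N ≥ 2`, `t > 0`: `Φ_t ∈ L²` for all small `δ ≠ 0` and `Var_δ(Φ_t) → Var_0(Φ_t)` as `δ → 0`,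
`δ ≠ 0`, the limit being the variance along the equal-temperature member `μ N T T` (kernel-level variance formula at each
`δ`, uniform exponential moments and weak convergence of the NESS family — Helpers 1–5 of K6b verbatim —, and the
δ-continuity of the pairing `∫ J_tot (P^δ_r J_tot) dμ_δ` at every lag, Helpers 6–8 of K6b with `j_b` replaced by `J_tot`,
which is dominated by `C e^{εH}` as well). -/
def TimeIntegratedCurrentVarianceContinuity : Prop :=
    ∀ ω₂ lam β γ : ℝ, 0 < ω₂ → 0 < lam → 0 < β → 0 < γ →
    (∀ (N : ℕ) (T_L T_R : ℝ), 0 < T_L → 0 < T_R → ∀ μ ν : Measure (PhaseSpace N),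
      (pinnedChain ω₂ lam β γ).IsSteadyState N T_L T_R μ →
      (pinnedChain ω₂ lam β γ).IsSteadyState N T_L T_R ν → μ = ν) →
    ∀ μ : (N : ℕ) → ℝ → ℝ → Measure (PhaseSpace N),
      (∀ (N : ℕ) (T_L T_R : ℝ), 0 < T_L → 0 < T_R →
        (pinnedChain ω₂ lam β γ).IsSteadyState N T_L T_R (μ N T_L T_R)) →
    ∀ T : ℝ, 0 < T → ∀ N : ℕ, 2 ≤ N → ∀ t : ℝ, 0 < t →
      (∀ᶠ δ in 𝓝[≠] (0 : ℝ), MemLp (timeIntegratedCurrent (pinnedChain ω₂ lam β γ) N (T + δ / 2) (T - δ / 2) t) 2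
        ((μ N (T + δ / 2) (T - δ / 2)).prod wienerPair)) ∧
      Tendsto (fun δ : ℝ => variance (timeIntegratedCurrent (pinnedChain ω₂ lam β γ) N (T + δ / 2) (T - δ / 2) t)
          ((μ N (T + δ / 2) (T - δ / 2)).prod wienerPair)) (𝓝[≠] 0)
        (𝓝 (variance (timeIntegratedCurrent (pinnedChain ω₂ lam β γ) N T T t) ((μ N T T).prod wienerPair)))

/-- **`TotalHeatPathwiseIdentity`** (part 4; fixed `N`, size M — pure calculus along the flow, no probability): for the
pinned chain (`ω₂ > 0`, `lam, β, γ ≥ 0`), `N ≥ 2`, bath sites `i0 = 0`, `iN = N - 1`, any index `ib`, any temperatures,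
`t ≥ 0`, EVERY initial point `z` and EVERY raw noise sample `w`: the total-heat observable of the raw observable of the
forward path equals the time-integrated total current, `(N-1)·Q_L - (M(z_t) - M(z)) = Σ_b ∫₀ᵗ j_b(z_s) ds`. Proof: for
each real bond `b ≤ N - 2`, `s ↦ E_{≤b}(z_s) - p_0(s)²/2` is `C¹` along the flow (positions and interior momenta are `C¹`:
`z - (0, η)` is `C¹` with derivative the drift, `LangevinChainSDE`, and the noise `η` lives on the bath momenta only) with
derivative `p_0 ∂_{q_0}H(z_s) - j_b(z_s)` (the interior forces telescope, cf.
`SubdiffusiveBondHeat.generator_siteEnergy` for `b = 0`); integrate on `[0, t]` (`Q_L = Δ(p_0²/2) + I_L` by definition of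
`leftHeat`) and sum over `b`. -/
def TotalHeatPathwiseIdentity : Prop :=
    ∀ ω₂ lam β γ : ℝ, 0 < ω₂ → 0 ≤ lam → 0 ≤ β → 0 ≤ γ →
    ∀ (N : ℕ) (i0 iN ib : Fin N), 2 ≤ N → i0.val = 0 → iN.val = N - 1 →
    ∀ (T_L T_R t : ℝ), 0 ≤ t → ∀ (z : PhaseSpace N) (w : WienerPair),
      totalHeatObs (pinnedChain ω₂ lam β γ) N i0
          (rawObs (pinnedChain ω₂ lam β γ) N i0 iN ib t z (fwdPath (pinnedChain ω₂ lam β γ) N T_L T_R z w)) =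
        timeIntegratedCurrent (pinnedChain ω₂ lam β γ) N T_L T_R t (z, w)

/-- **The lever's transfer statement** (part 5; size M–L, the pattern is `LinearResponseFTUR.Line.transfer`): parts 1–4
imply `TotalCurrentFTUR` — at each small `δ ≠ 0` instantiate the vendored Hasegawa–Van Vu FTUR
(`Literature.Probability.Entropy.HasegawaVanVu2019_FTUR_holds`) on `Obs N` with `P := fluxLaw … i0 iN i0 (T±δ/2) t μ_δ`,
`ι := flipObs` and the odd observable `φ := totalHeatObs` (`totalHeatObs_flipObs`), using the landed entropy balance
`LinearResponseFTUR.stub_entropyBalance (gdb_of_duality_and_girsanov stub_pathLebesgueDuality stub_antiDampedGirsanov)`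
and `LinearResponseFTUR.stub_steadyHeatRates` for `⟨Σ_t⟩ = KL(μ_δ‖Θ_*μ_δ) + tJ_δ(1/(T-δ/2) - 1/(T+δ/2))`; transport mean,
square-integrability and variance of `φ` to `Φ_t` on `μ_δ ⊗ W` along the measurable raw-observable map (part 4,
`fluxLaw_eq`, `variance_map`); parts 1–3 and `LinearResponseFTUR.ness_eq_gibbsMeasure` give `m_δ/δ → t D_N`,
`Var_δ → 2∫₀ᵗ(t-s)C_N(s)ds`; conclude with `LinearResponseFTUR.Line.shape_of_hvv_family` fed with the RESCALED family
`m δ = t·totalCurrent(μ_δ)/(N-1)`, `v δ = Var_δ(Φ_t)/(N-1)²`, `G = D_N/(N-1)` (the entropy factor carries the PER-BOND current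
`J_δ = totalCurrent/(N-1)`, the mean the TOTAL one: this `(N-1)²` mismatch is the lever) and multiply back by `(N-1)²`. -/
def TotalCurrentFTURTransfer : Prop :=
  TimeIntegratedCurrentMean → EquilibriumTimeIntegratedCurrentVariance → TimeIntegratedCurrentVarianceContinuity →
    TotalHeatPathwiseIdentity → TotalCurrentFTUR

end Summit.AtomisticToContinuum.FouriersLaw.Theorems.NonBallistic.DrudeLine

end
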